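import Mathlib
import HarnessLib
import Literature.RingTheory.CohomologyAnnihilator.StableAnnihilation
import Literature.RingTheory.CohomologyAnnihilator.SyzygyBasic
import Literature.RingTheory.CohomologyAnnihilator.SyzygyDescent

/-!
# Crux `NoZenoR` / `NoZeno` (stmt-ResolutionOfSingularities-19943 / -16483), line
# `sandwich-cluster`, S3 Layer 2 — CA-layer I: the STABLE ANNIHILATOR (A0), the REDUCTION
# LEMMA (CA1) and DUALITY (CA3)

Route `ResolutionOfSingularities/HomologicalConductor`.  OURS (cell res-hironaka, crux chain W4.4,
seat res-L0-w44-stub-5 = res-D-pv-037); nothing here is a statement of the manuscript under review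
(Hironaka 2017); AI-written, weaker than expert review.

CRUX-PLAN W4.4 v5/v6 §A (planner res-L0-w44-plan-1, `SketchCALayer.lean` rev 2, items A0 / CA1 / CA3
— signatures verbatim; audited 6/6 PASS-as-typed by res-L0-w44-tri-1, TRIAGE v4 §7).  THEOREM A
(principality of `ca(T_m)` at the sky points of a sandwiched stage, the residual `stub_skyPrincipal`
of the registered stub `stub_caPrincipalUpstairsCore`) consumes the tree's cohomology annihilator
ideals `caⁿ(T)` (`Literature.RingTheory.CohomologyAnnihilator.cohomologyAnnihilatorOfDegree`) in the
form «`x ∈ caⁿ(T)` iff `x` STABLY ANNIHILATES (the dual of) every high syzygy module» (CA4 =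
CA1 + CA0 + CA3).  This file is the scheme-free commutative algebra behind that reformulation —
folklore in the style of [IyengarTakahashi2014, §2] (Remark 2.3: dimension shifting; Remark 2.13: a
homothety killing the class of a projective presentation factors through the cover) over the tree's
`StableAnnihilation.lean`, `StrongGenerator.lean` (`IsSyzygy`), `SyzygyBasic.lean`,
`SyzygyDescent.lean`:

* `StablyAnnihilates T x M` (A0) — the homothety `x • 𝟙 M` factors through a finitely generated
  projective module, `M —ι→ P —π→ M` with `ι ≫ π = x • 𝟙 M` («`x ∈ s̲ann(M)`», the stable
  annihilator of `M`: `x • 𝟙 M` vanishes in the stable category `mod T / proj T`);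
* `StablyAnnihilates.smul_ext_eq_zero` — then `x • Extⁱ(M, N) = 0` for every `N` and every `i ≥ 1`
  (tree `smul_ext_eq_zero_of_comp_eq_smul_id`); conversely
  `stablyAnnihilates_of_forall_smul_ext_one_eq_zero` — over a noetherian ring a finitely generated
  `K` with `x • Ext¹(K, N) = 0` for all finitely generated `N` is stably annihilated by `x` (the
  class of `0 → ΩK → P → K → 0` is killed, so `x • 𝟙 K` lifts to the cover, Remark 2.13);
  together `stablyAnnihilates_iff_forall_smul_ext_one_eq_zero`; `StablyAnnihilates.of_iso`;
  `stablyAnnihilates_of_mem_of_isSyzygy_succ` (= tree `exists_comp_eq_smul_id_of_isSyzygy`);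
* **CA1** `mem_cohomologyAnnihilatorOfDegree_succ_iff_forall_isSyzygy` — for noetherian `T` and
  every `n`: `x ∈ caⁿ⁺¹(T)` iff `x` stably annihilates every `n`-th syzygy module of every finitely
  generated module (dimension shifting along the syzygy chain: tree `ext_smul_eq_zero_of_isSyzygy`,
  `mem_extAnnihilatorFrom_of_isSyzygy`); `mem_cohomologyAnnihilator_iff_exists_forall_isSyzygy`
  is the `ca(T)` form;
* **CA3** `stablyAnnihilates_iff_dual` — for a reflexive `L`: `x ∈ s̲ann(L)` iff `x ∈ s̲ann(L*)`
  (dualise a factorisation, `(x • 𝟙)* = x • 𝟙`, and `L ≅ L**` by `Module.evalEquiv`); the forward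
  direction `StablyAnnihilates.dual` holds for every module over every commutative ring.

References: S. B. Iyengar, R. Takahashi, *Annihilation of cohomology and strong generation of module
categories*, IMRN 2016; arXiv:1404.1476 — §2, Remark 2.3, Remark 2.13 [`IyengarTakahashi2014`].
-/

noncomputable section

-- single-problem summit: the doubled namespace component `ResolutionOfSingularities` is forced
set_option linter.dupNamespace false

namespace Summit.ResolutionOfSingularities.ResolutionOfSingularities.Theorems.NoZeno.SandwichCluster

open CategoryTheory CategoryTheory.Abelian Literature.RingTheory.CohomologyAnnihilator

universe u

variable (T : Type u) [CommRing T]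

/-! ## A0: the stable annihilator -/

/-- `x` STABLY ANNIHILATES `M`: the homothety `x • 𝟙 M` factors through a finitely generated
projective module, `M —ι→ P —π→ M` with `ι ≫ π = x • 𝟙 M` (`x ∈ s̲ann(M)`, the stable annihilator:
`x • 𝟙 M` vanishes in the stable category `mod T / proj T`; the shape of factorisation produced by
[IyengarTakahashi2014, Remark 2.13] and consumed by `smul_ext_eq_zero_of_comp_eq_smul_id`).
[cite: IyengarTakahashi2014, Remark 2.13] -/
def StablyAnnihilates (x : T) (M : ModuleCat.{u} T) : Prop :=
  ∃ (P : ModuleCat.{u} T) (_ : Module.Finite T P) (_ : Projective P) (ι : M ⟶ P) (π : P ⟶ M),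
    ι ≫ π = x • 𝟙 M

variable {T}

/-- Pointwise form of a factorisation `ι ≫ π = x • 𝟙 M` in `ModuleCat T`: `π (ι m) = x • m`.
[folklore] -/
theorem apply_apply_eq_smul_of_comp_eq_smul_id {M P : ModuleCat.{u} T} {ι : M ⟶ P} {π : P ⟶ M}
    {x : T} (h : ι ≫ π = x • 𝟙 M) (m : M) : π.hom (ι.hom m) = x • m := by
  have := congrArg (fun f : M ⟶ M => f.hom m) h
  simpa using this

/-- **Stable annihilation kills positive `Ext`**: if `x` stably annihilates `M` then
`x • Extⁱ(M, N) = 0` for every `T`-module `N` and every `i ≥ 1` (the factor `Extⁱ(P, N)` vanishes).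
[cite: IyengarTakahashi2014, Remark 2.13] -/
theorem StablyAnnihilates.smul_ext_eq_zero {x : T} {M : ModuleCat.{u} T}
    (h : StablyAnnihilates T x M) (N : ModuleCat.{u} T) {i : ℕ} (hi : 1 ≤ i) (e : Ext.{u} M N i) :
    x • e = 0 := by
  obtain ⟨P, _, hP, ι, π, hιπ⟩ := h
  haveI := hP
  exact smul_ext_eq_zero_of_comp_eq_smul_id ι π hιπ hi e

/-- Stable annihilation is invariant under isomorphism (conjugate the factorisation). [folklore] -/
theorem StablyAnnihilates.of_iso {x : T} {M M' : ModuleCat.{u} T} (h : StablyAnnihilates T x M)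
    (e : M ≅ M') : StablyAnnihilates T x M' := by
  obtain ⟨P, hPfin, hP, ι, π, hιπ⟩ := h
  refine ⟨P, hPfin, hP, e.inv ≫ ι, π ≫ e.hom, ?_⟩
  rw [Category.assoc, ← Category.assoc ι, hιπ, Linear.smul_comp, Linear.comp_smul, Category.id_comp,
    e.inv_hom_id]

/-- **`caᵗ⁺¹(T)` stably annihilates `(t+1)`-th syzygies** — the sibling file's
`exists_comp_eq_smul_id_of_isSyzygy` (`SyzygyDescent.lean`) in the present vocabulary: for
noetherian `T`, `x ∈ caᵗ⁺¹(T)` and `K` a `(t+1)`-th syzygy of a finitely generated `M`, `x` stably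
annihilates `K` (so `caᵗ⁺¹(T)` stably annihilates `Ωᵗ M` — the reduction lemma below — AND
`Ωᵗ⁺¹ M`). [folklore] -/
theorem stablyAnnihilates_of_mem_of_isSyzygy_succ [IsNoetherianRing T] {t : ℕ} {x : T}
    (hx : x ∈ cohomologyAnnihilatorOfDegree T (t + 1)) {M K : ModuleCat.{u} T} [Module.Finite T M]
    (hK : IsSyzygy (t + 1) M K) : StablyAnnihilates T x K :=
  exists_comp_eq_smul_id_of_isSyzygy hx hK

/-- Over a noetherian ring, a finitely generated module `K` such that `x • Ext¹(K, N) = 0` for every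
FINITELY GENERATED `N` is stably annihilated by `x`: for a finite presentation `0 → K₁ → P → K → 0`
(`P` finite free, `K₁` finitely generated) the class in `Ext¹(K, K₁)` is killed by `x`, so `x • 𝟙 K`
lifts along `P ↠ K` (tree `exists_comp_eq_smul_id_X₃_of_smul_extClass_eq_zero`).
[cite: IyengarTakahashi2014, Remark 2.13] -/
theorem stablyAnnihilates_of_forall_smul_ext_one_eq_zero [IsNoetherianRing T] {x : T}
    (K : ModuleCat.{u} T) [Module.Finite T K]
    (h : ∀ N : ModuleCat.{u} T, Module.Finite T N → ∀ e : Ext.{u} K N 1, x • e = 0) :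
    StablyAnnihilates T x K := by
  obtain ⟨P, _, _, _, _, f, surjf⟩ := Module.exists_finite_presentation T K
  have hS := LinearMap.shortExact_shortComplexKer surjf
  haveI : Module.Finite T (LinearMap.ker f) := Module.IsNoetherian.finite T _
  have hcl : x • hS.extClass = 0 := h (ModuleCat.of T (LinearMap.ker f)) inferInstance _
  obtain ⟨ψ, hψ⟩ := exists_comp_eq_smul_id_X₃_of_smul_extClass_eq_zero hS hcl
  exact ⟨ModuleCat.of T P, inferInstance, inferInstance, ψ, ModuleCat.ofHom f, hψ⟩

/-- Over a noetherian ring and for `K` finitely generated: `x` stably annihilates `K` iff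
`x • Ext¹(K, N) = 0` for every finitely generated `N`. [cite: IyengarTakahashi2014, Remark 2.13] -/
theorem stablyAnnihilates_iff_forall_smul_ext_one_eq_zero [IsNoetherianRing T] (x : T)
    (K : ModuleCat.{u} T) [Module.Finite T K] :
    StablyAnnihilates T x K ↔
      ∀ N : ModuleCat.{u} T, Module.Finite T N → ∀ e : Ext.{u} K N 1, x • e = 0 :=
  ⟨fun h N _ e => h.smul_ext_eq_zero N le_rfl e, stablyAnnihilates_of_forall_smul_ext_one_eq_zero K⟩

/-! ## CA1, the reduction lemma: `caⁿ⁺¹(T)` is the stable annihilator of `n`-th syzygies -/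

/-- **The REDUCTION LEMMA** (Iyengar–Takahashi §2 folklore; item CA1 of the W4.4 CA-layer):
for a noetherian ring `T` and any `n` (`n = 0` included: `IsSyzygy 0 M K` is `K ≅ M`),
`x ∈ caⁿ⁺¹(T)` iff `x` stably annihilates every `n`-th syzygy module `K = Ωⁿ M` of every finitely
generated `T`-module `M`.  `⇒`: `x` kills `Extⁿ⁺¹(M, N) ↩ Ext¹(Ωⁿ M, N)` (injective dimension
shifting, `ext_smul_eq_zero_of_isSyzygy`), hence the class of `0 → Ωⁿ⁺¹M → P → ΩⁿM → 0`, so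
`x • 𝟙 (Ωⁿ M)` lifts to the cover.  `⇐`: a factorisation through a projective kills
`Ext^{≥ 1}(Ωⁿ M, −)`, which maps ONTO `Ext^{≥ n+1}(M, −)` (surjective dimension shifting,
`mem_extAnnihilatorFrom_of_isSyzygy`). [cite: IyengarTakahashi2014, Remark 2.3, Remark 2.13] -/
theorem mem_cohomologyAnnihilatorOfDegree_succ_iff_forall_isSyzygy [IsNoetherianRing T] {n : ℕ}
    (x : T) :
    x ∈ cohomologyAnnihilatorOfDegree T (n + 1) ↔
      ∀ (M K : ModuleCat.{u} T), Module.Finite T M → IsSyzygy n M K → StablyAnnihilates T x K := by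
  constructor
  · intro hx M K hM hK
    haveI := hM
    haveI : Module.Finite T K := finite_of_isSyzygy n hM hK
    refine stablyAnnihilates_of_forall_smul_ext_one_eq_zero K fun N hN e => ?_
    haveI := hN
    refine ext_smul_eq_zero_of_isSyzygy n hK N 1 le_rfl x (fun e' => ?_) e
    exact smul_eq_zero_of_mem_cohomologyAnnihilatorOfDegree hx (i := 1 + n) (by omega) e'
  · intro h
    rw [mem_cohomologyAnnihilatorOfDegree_iff_forall_mem_extAnnihilatorFrom]
    intro M hM
    haveI := hM
    obtain ⟨K, _, hK⟩ := exists_isSyzygy M n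
    have h1 : x ∈ extAnnihilatorFrom K 1 := by
      rw [mem_extAnnihilatorFrom_iff]
      intro i hi N _ e
      exact (h M K hM hK).smul_ext_eq_zero N hi e
    have := mem_extAnnihilatorFrom_of_isSyzygy n hK h1
    rwa [Nat.add_comm] at this

/-- The reduction lemma in `ca(T)`-language: for noetherian `T`, `x ∈ ca(T)` iff for SOME `n`, `x`
stably annihilates every `n`-th syzygy of every finitely generated module (`ca(T) = ⋃ₙ caⁿ⁺¹(T)`
as `ca⁰ ⊆ ca¹`). [cite: IyengarTakahashi2014, Definition 2.1, Remark 2.13] -/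
theorem mem_cohomologyAnnihilator_iff_exists_forall_isSyzygy [IsNoetherianRing T] (x : T) :
    x ∈ cohomologyAnnihilator T ↔ ∃ n : ℕ,
      ∀ (M K : ModuleCat.{u} T), Module.Finite T M → IsSyzygy n M K → StablyAnnihilates T x K := by
  rw [mem_cohomologyAnnihilator_iff]
  constructor
  · rintro ⟨n, hn⟩
    exact ⟨n, (mem_cohomologyAnnihilatorOfDegree_succ_iff_forall_isSyzygy x).mp
      (cohomologyAnnihilatorOfDegree_mono (Nat.le_succ n) hn)⟩
  · rintro ⟨n, hn⟩
    exact ⟨n + 1, (mem_cohomologyAnnihilatorOfDegree_succ_iff_forall_isSyzygy x).mpr hn⟩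

/-! ## CA3: stable annihilation is self-dual on reflexive modules -/

/-- The factorisation `ι ≫ π = x • 𝟙 M` dualises: `π* ∘ ι*`… precisely, for `ψ ∈ M*`,
`ι* (π* ψ) = ψ ∘ π ∘ ι = x • ψ`. [folklore] -/
theorem dualMap_dualMap_apply_of_comp_eq_smul_id {M P : ModuleCat.{u} T} {ι : M ⟶ P} {π : P ⟶ M}
    {x : T} (h : ι ≫ π = x • 𝟙 M) (ψ : Module.Dual T M) :
    ι.hom.dualMap (π.hom.dualMap ψ) = x • ψ := by
  ext m
  simp only [LinearMap.dualMap_apply, apply_apply_eq_smul_of_comp_eq_smul_id h m, map_smul,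
    LinearMap.smul_apply]

/-- **Duality, forward direction (any module, any commutative ring)**: if `x` stably annihilates `M`
then `x` stably annihilates the dual `M* = Hom_T(M, T)` — dualise `M —ι→ P —π→ M` to
`M* —π*→ P* —ι*→ M*`; the dual of a finitely generated projective is finitely generated projective
(Mathlib `Module.dual_finite`, `Module.dual_projective`). [folklore] -/
theorem StablyAnnihilates.dual {x : T} {M : ModuleCat.{u} T} (h : StablyAnnihilates T x M) :
    StablyAnnihilates T x (ModuleCat.of T (Module.Dual T M)) := by
  obtain ⟨P, hPfin, hP, ι, π, hιπ⟩ := h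
  haveI := hPfin
  haveI := hP
  haveI : Module.Projective T P := P.projective_of_module_projective
  refine ⟨ModuleCat.of T (Module.Dual T P), inferInstance, inferInstance,
    ModuleCat.ofHom π.hom.dualMap, ModuleCat.ofHom ι.hom.dualMap, ?_⟩
  ext ψ m
  simp only [ModuleCat.hom_comp, ModuleCat.hom_ofHom, LinearMap.coe_comp, Function.comp_apply,
    LinearMap.dualMap_apply, apply_apply_eq_smul_of_comp_eq_smul_id hιπ m, map_smul,
    ModuleCat.hom_smul, ModuleCat.hom_id, LinearMap.smul_apply, LinearMap.id_coe, id_eq]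

/-- **Duality** (item CA3 of the W4.4 CA-layer): for a REFLEXIVE module `L` (`L ≅ L**` via
`Module.Dual.eval`), `x` stably annihilates `L` iff it stably annihilates the dual
`L* = Hom_T(L, T)`.  `⇒` is `StablyAnnihilates.dual`; for `⇐` dualise a factorisation
`L* —ι→ P —π→ L*` to `L ≅ L** —π*→ P* —ι*→ L** ≅ L`. [folklore] -/
theorem stablyAnnihilates_iff_dual (x : T) (L : ModuleCat.{u} T) (hL : Module.IsReflexive T L) :
    StablyAnnihilates T x L ↔ StablyAnnihilates T x (ModuleCat.of T (Module.Dual T L)) := by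
  refine ⟨StablyAnnihilates.dual, fun h => ?_⟩
  obtain ⟨P, hPfin, hP, ι, π, hιπ⟩ := h
  haveI := hPfin
  haveI := hP
  haveI := hL
  haveI : Module.Projective T P := P.projective_of_module_projective
  let e : L ≃ₗ[T] Module.Dual T (Module.Dual T L) := Module.evalEquiv T L
  refine ⟨ModuleCat.of T (Module.Dual T P), inferInstance, inferInstance,
    ModuleCat.ofHom (π.hom.dualMap ∘ₗ e.toLinearMap),
    ModuleCat.ofHom (e.symm.toLinearMap ∘ₗ ι.hom.dualMap), ?_⟩
  ext l
  have hψ : ι.hom.dualMap (π.hom.dualMap (e l)) = x • e l :=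
    dualMap_dualMap_apply_of_comp_eq_smul_id hιπ (e l)
  simp only [ModuleCat.hom_comp, ModuleCat.hom_ofHom, LinearMap.coe_comp, LinearEquiv.coe_coe,
    Function.comp_apply, hψ, map_smul, LinearEquiv.symm_apply_apply, ModuleCat.hom_smul,
    ModuleCat.hom_id, LinearMap.smul_apply, LinearMap.id_coe, id_eq]

end Summit.ResolutionOfSingularities.ResolutionOfSingularities.Theorems.NoZeno.SandwichCluster

end
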